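import Summits.ValiantsHypothesis.ValiantsHypothesis.Theorems.KPlusLogSqLawTropicalClassMonotone

/-!
# Route «KPlusLogSqLaw», crux `WeakLifting` (stmt-ValiantsHypothesis-19561), docket D2 — SWITCHES ARE FRESH, RECOMBINATIONS MOVE THE PERMUTATION

HONEST FRAMING.  Helper file (cell `pub-symmetroid`, seat val-sym-lift-p3 g26, 2026-08-29) `--supports` the crux
`Summit.ValiantsHypothesis.ValiantsHypothesis.Theses.KPlusLogSqLaw.WeakLifting` (ledger item `stmt-ValiantsHypothesis-19561`, route `KPlusLogSqLaw`;
lineage docket D2, the count `Z` of «zero-fresh» steps of a dominant chain in `n + m ≤ #used incidences + Z`, `…TropicalFreshIncidences`).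
STRUCTURE law for dominant terms of an ARBITRARY dominance design (any format, exponents, valuations; no sign hypothesis); bounds no row; asserts
nothing about `WeakLifting`, `TropicalB`, `Lifting`, `KPlusLogSqLaw`, `MatrixDescartes` (stmt-ValiantsHypothesis-18050) or VP ≠ VNP.  No `def`.

THE LAWS (all from the tree's per-entry class monotonicity `d_lt_of_isDominant_of_sameEntry`, p421342 / lift-p2's `d_lt_of_dominant_entry`).
Along terms `p₀, …, p_n` dominant at strictly increasing slopes `θ₀ < ⋯ < θ_n`:
* `d_le_of_samePosition` — if positions `j ≤ k` put the same ROW in column `b`, the exponent of the class used there does not decrease;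
* `d_eq_between_of_samePosition` — CLASS CONVEXITY AT A POSITION: if `j ≤ y ≤ k` all put the same row in column `b` and `p_j`, `p_k` use classes
  of equal exponent there, so does `p_y` (a position never returns to an exponent it has left);
* **`switch_fresh`** — SWITCHES ARE FRESH: if the step `k → k+1` keeps the row of column `b` but changes its class, then the incidence that `p_{k+1}`
  carries in column `b` (row, class) is carried by NO earlier term `p_j`, `j ≤ k`, in that column;
* **`perm_ne_of_zeroFresh`** — RECOMBINATIONS MOVE THE PERMUTATION: if every incidence of `p_{k+1}` is carried (in the same column) by some
  earlier term (a «zero-fresh» = recombination step) and `p_{k+1} ≠ p_k`, then the permutations differ, `(p_{k+1}).1 ≠ (p_k).1`; equivalently a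
  permutation-keeping step always pays at least one never-used incidence.
So the `Z` of the fresh-incidence inequality counts permutation-changing steps only, and every zero-fresh step is a re-matching (located: a single
cycle on 2–4 columns of a term 1–3 positions back, HOME/val-sym-lift-p3/g26/memo).  [folklore; immediate from the cited tree lemma]
-/

set_option linter.dupNamespace false
set_option autoImplicit false

namespace Summit.ValiantsHypothesis.ValiantsHypothesis.Theorems.KPlusLogSqLaw

open Summit.ValiantsHypothesis.ValiantsHypothesis.Theorems.MatrixDescartes.Negative
open Summit.ValiantsHypothesis.ValiantsHypothesis.Theorems.LacunarySymmetroidMatrixDescartes.TropicalCensus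
open scoped BigOperators
open Finset

namespace SwitchFresh

variable {m K : ℕ}

/-- **Exponents do not decrease at a position.**  `j ≤ k`, same row in column `b` ⇒ `d ((p j).2 b) ≤ d ((p k).2 b)`. -/
theorem d_le_of_samePosition {n : ℕ} (d : Fin K → ℕ) (v ε : Fin m → Fin m → Fin K → ℤ)
    (θ : Fin (n + 1) → ℤ) (hθ : StrictMono θ) (p : Fin (n + 1) → Equiv.Perm (Fin m) × (Fin m → Fin K))
    (hdom : ∀ r, IsDominant d v ε (θ r) (p r)) {j k : Fin (n + 1)} (hjk : j ≤ k) (b : Fin m)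
    (hrow : (p j).1 b = (p k).1 b) : d ((p j).2 b) ≤ d ((p k).2 b) := by
  rcases hjk.lt_or_eq with hlt | heq
  · by_cases hc : (p j).2 b = (p k).2 b
    · rw [hc]
    · exact le_of_lt (d_lt_of_isDominant_of_sameEntry d v ε (hθ hlt) (hdom j) (hdom k) b hrow hc)
  · subst heq; exact le_rfl

/-- **Class convexity at a position.**  `j ≤ y ≤ k`, all three put the same row in column `b`, and the classes of `p j` and `p k` there have equal
exponents ⇒ so does the class of `p y`. -/
theorem d_eq_between_of_samePosition {n : ℕ} (d : Fin K → ℕ) (v ε : Fin m → Fin m → Fin K → ℤ)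
    (θ : Fin (n + 1) → ℤ) (hθ : StrictMono θ) (p : Fin (n + 1) → Equiv.Perm (Fin m) × (Fin m → Fin K))
    (hdom : ∀ r, IsDominant d v ε (θ r) (p r)) {j y k : Fin (n + 1)} (hjy : j ≤ y) (hyk : y ≤ k) (b : Fin m)
    (hrow₁ : (p j).1 b = (p y).1 b) (hrow₂ : (p y).1 b = (p k).1 b) (hd : d ((p j).2 b) = d ((p k).2 b)) :
    d ((p y).2 b) = d ((p k).2 b) := by
  have h1 := d_le_of_samePosition d v ε θ hθ p hdom hjy b hrow₁
  have h2 := d_le_of_samePosition d v ε θ hθ p hdom hyk b hrow₂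
  omega

/-- **SWITCHES ARE FRESH.**  If the step `k.castSucc → k.succ` keeps the row of column `b` and changes the class there, then no earlier term
`p j`, `j ≤ k.castSucc`, carries in column `b` the incidence (row, class) of `p k.succ`. -/
theorem switch_fresh {n : ℕ} (d : Fin K → ℕ) (v ε : Fin m → Fin m → Fin K → ℤ)
    (θ : Fin (n + 1) → ℤ) (hθ : StrictMono θ) (p : Fin (n + 1) → Equiv.Perm (Fin m) × (Fin m → Fin K))
    (hdom : ∀ r, IsDominant d v ε (θ r) (p r)) (k : Fin n) (b : Fin m)
    (hrow : (p k.castSucc).1 b = (p k.succ).1 b) (hcls : (p k.castSucc).2 b ≠ (p k.succ).2 b)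
    (j : Fin (n + 1)) (hj : j ≤ k.castSucc) :
    ((p j).1 b, (p j).2 b) ≠ ((p k.succ).1 b, (p k.succ).2 b) := by
  intro h
  have hrow' : (p j).1 b = (p k.succ).1 b := (Prod.mk.inj h).1
  have hcls' : (p j).2 b = (p k.succ).2 b := (Prod.mk.inj h).2
  -- the step strictly raises the exponent at the position …
  have hup : d ((p k.castSucc).2 b) < d ((p k.succ).2 b) :=
    d_lt_of_isDominant_of_sameEntry d v ε (hθ (Fin.castSucc_lt_succ (i := k))) (hdom k.castSucc) (hdom k.succ) b hrow hcls
  -- … while from `j` to `k.castSucc` it cannot decrease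
  have hle : d ((p j).2 b) ≤ d ((p k.castSucc).2 b) :=
    d_le_of_samePosition d v ε θ hθ p hdom hj b (hrow'.trans hrow.symm)
  rw [hcls'] at hle
  omega

/-- **RECOMBINATIONS MOVE THE PERMUTATION.**  If every incidence of `p k.succ` is carried, in the same column, by some earlier term (a zero-fresh
step) and `p k.succ ≠ p k.castSucc`, then the permutations of `p k.castSucc` and `p k.succ` differ. -/
theorem perm_ne_of_zeroFresh {n : ℕ} (d : Fin K → ℕ) (v ε : Fin m → Fin m → Fin K → ℤ)
    (θ : Fin (n + 1) → ℤ) (hθ : StrictMono θ) (p : Fin (n + 1) → Equiv.Perm (Fin m) × (Fin m → Fin K))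
    (hdom : ∀ r, IsDominant d v ε (θ r) (p r)) (k : Fin n) (hne : p k.succ ≠ p k.castSucc)
    (hzero : ∀ b : Fin m, ∃ j : Fin (n + 1), j ≤ k.castSucc ∧ ((p j).1 b, (p j).2 b) = ((p k.succ).1 b, (p k.succ).2 b)) :
    (p k.succ).1 ≠ (p k.castSucc).1 := by
  intro hperm
  -- a column where the class changes
  obtain ⟨b, hb⟩ : ∃ b, (p k.castSucc).2 b ≠ (p k.succ).2 b := by
    by_contra hall
    push Not at hall
    apply hne
    exact Prod.ext hperm (funext fun b => (hall b).symm)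
  obtain ⟨j, hj, hjb⟩ := hzero b
  exact switch_fresh d v ε θ hθ p hdom k b (congrFun (congrArg (⇑) hperm.symm) b) hb j hj hjb

/-- **Equivalently: a permutation-keeping step pays a never-used incidence.**  If `(p k.succ).1 = (p k.castSucc).1` and the two terms differ, some
column of `p k.succ` carries an incidence used by no `p j`, `j ≤ k.castSucc`. -/
theorem exists_fresh_of_perm_eq {n : ℕ} (d : Fin K → ℕ) (v ε : Fin m → Fin m → Fin K → ℤ)
    (θ : Fin (n + 1) → ℤ) (hθ : StrictMono θ) (p : Fin (n + 1) → Equiv.Perm (Fin m) × (Fin m → Fin K))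
    (hdom : ∀ r, IsDominant d v ε (θ r) (p r)) (k : Fin n) (hne : p k.succ ≠ p k.castSucc)
    (hperm : (p k.succ).1 = (p k.castSucc).1) :
    ∃ b : Fin m, ∀ j : Fin (n + 1), j ≤ k.castSucc → ((p j).1 b, (p j).2 b) ≠ ((p k.succ).1 b, (p k.succ).2 b) := by
  by_contra h
  push Not at h
  exact perm_ne_of_zeroFresh d v ε θ hθ p hdom k hne (fun b => (h b).imp fun j hj => ⟨hj.1, hj.2⟩) hperm

end SwitchFresh

end Summit.ValiantsHypothesis.ValiantsHypothesis.Theorems.KPlusLogSqLaw
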